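import Literature.Geometry.Lorentzian.TameFamilyOffCompact
import Literature.Geometry.Lorentzian.AFEndBreathingData
import Literature.Geometry.Lorentzian.AdmissibleDataLocality
import HarnessLib

/-!
# The breathing curve of an initial data set is a TAME, injective, immersed curve of isometric
# copies — self-witnesses for tame Christodoulou genericity

For an initial data set `d` on a `3`-manifold `X` with an asymptotically flat end `e` and breathing
data `B : e.BreathingData z₀ r` (a coordinate ball far out on the end, `AFEndBreathing.lean`), the
**breathing curve** is the one-parameter family `c ↦ E_{c₀}(d) = (breathe (σ c₀))^* d`
(`AFEnd.breatheFamily`, `AFEndBreathingData.lean`; `c₀ = c 0` the coordinate of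
`c ∈ ℝ¹ = EuclideanSpace ℝ (Fin 1)`): pull-backs of `d` along compactly supported diffeomorphisms,
hence ISOMETRIC COPIES of `d` agreeing with `d` off the compact moved set `breatheCore e z₀ r`.
This file proves that it is a legal witness curve for the TAME genericity notion of the final
state conjecture (`TameGenericity.lean`) through `d` itself:

* `isSmoothDataFamily_breatheCurve` — jointly smooth (`contMDiff_breatheFamily_family_h/k`);
* `breatheCurve_zero`, `breatheCurve_agree_off_core` — through `d`, equal to `d` off the core;
* `injective_breatheCurve` — injective (`injective_marker`: the centre value
  `h_{E t}(x₀)(v₀, v₀) = (1 + σ t)² h_d(x₀)(v₀, v₀)` is strictly monotone in `t`);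
* `isImmersedAtZero_breatheCurve` — IMMERSED at `0`: the `c`-derivative at `0` of
  `c ↦ h_{E_{c₀}}(x₀)(v₀, v₀) = (1 + σ c₀)² h_d(x₀)(v₀, v₀)` in the direction `v` is
  `2 σ'(0) v₀ h_d(x₀)(v₀, v₀) ≠ 0` for `v ≠ 0` (`σ'(0) = s₀/π > 0`, `h_d` positive definite);
* `isTameDataFamily_restrict_breatheCurve` — TAME on every collared restriction `e.restrict _`,
  `R₁ > e.R`, of `e` when `e` is a sole end on which `d` is Dafermos–Rodnianski flat
  (`InitialDataSet.isTameDataFamily_restrict_of_agree_off_compact`, `TameFamilyOffCompact.lean`);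
* `breatheCurve_mem_admissibleVacuumData` — admissible when `d` is
  (`mem_admissibleVacuumData_of_agree_off_compact`, `isVacuumConstraintSolution_breatheFamily`);
* `InitialDataSet.exists_tame_selfWitness` — **through every admissible datum passes a tame,
  injective, immersed curve of admissible data agreeing with it off a compact set** (the
  anti-vacuity of the tame witness notion at every datum, and the SELF-WITNESS needed by relative
  genericity arguments for properties invariant under compactly supported diffeomorphisms).

Christodoulou, CQG 16 (1999) A23, p. A24 (genericity in a fixed space of data); Lee, *Introduction
to Smooth Manifolds* (2013), Prop. 2.25 (bump-function diffeomorphisms); Bartnik–Isenberg 2004, §2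
(diffeomorphism covariance of the constraints). Everything is proved; no definitions, no named
facts. Not here: transport of (maximal) vacuum Cauchy developments along the breathing
diffeomorphisms (what makes development-level properties of `d` pass to the members).
-/

noncomputable section

open Set Function Filter Metric TopologicalSpace Bundle
open scoped Manifold ContDiff Topology

namespace Literature.Geometry.Lorentzian

namespace AFEnd

variable {X : Type} [TopologicalSpace X] [ChartedSpace E3 X] [IsManifold (𝓡 3) ∞ X] [T2Space X]
  {e : AFEnd X} {z₀ : E3} {r : ℝ} (B : BreathingData e z₀ r) (d : InitialDataSet (𝓡 3) X)

/-- **The breathing curve is a jointly smooth one-parameter family** (read the breathing family of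
the constant `0`-parameter family `d` through the smooth coordinate `c ↦ c 0`).
[cite: LeeSmoothManifolds2013, Prop. 2.25] -/
theorem isSmoothDataFamily_breatheCurve :
    InitialDataSet.IsSmoothDataFamily 1
      (fun c : EuclideanSpace ℝ (Fin 1) ↦ breatheFamily B d (c 0)) := by
  have hpr : ContDiff ℝ ∞ (fun _ : EuclideanSpace ℝ (Fin 1) ↦ (0 : EuclideanSpace ℝ (Fin 0))) :=
    contDiff_const
  have hτ : ContDiff ℝ ∞ (fun c : EuclideanSpace ℝ (Fin 1) ↦ c 0) :=
    contDiff_piLp_apply (𝕜 := ℝ) (n := ∞) (p := 2) (E := fun _ : Fin 1 => ℝ) (i := 0)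
  have hG := InitialDataSet.isSmoothDataFamily_const 0 d
  exact ⟨contMDiff_breatheFamily_family_h B
      (pr := fun _ : EuclideanSpace ℝ (Fin 1) ↦ (0 : EuclideanSpace ℝ (Fin 0)))
      (τ := fun c : EuclideanSpace ℝ (Fin 1) ↦ c 0) (G := fun _ : EuclideanSpace ℝ (Fin 0) ↦ d)
      hpr hτ hG.1,
    contMDiff_breatheFamily_family_k B
      (pr := fun _ : EuclideanSpace ℝ (Fin 1) ↦ (0 : EuclideanSpace ℝ (Fin 0)))
      (τ := fun c : EuclideanSpace ℝ (Fin 1) ↦ c 0) (G := fun _ : EuclideanSpace ℝ (Fin 0) ↦ d)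
      hpr hτ hG.2⟩

/-- **The breathing curve passes through `d` at the parameter `0`** (`σ 0 = 0`, `breathe 0 = id`).
[folklore] -/
theorem breatheCurve_zero :
    (fun c : EuclideanSpace ℝ (Fin 1) ↦ breatheFamily B d (c 0)) 0 = d := by
  show breatheFamily B d ((0 : EuclideanSpace ℝ (Fin 1)) 0) = d
  have h00 : ((0 : EuclideanSpace ℝ (Fin 1)) 0 : ℝ) = 0 := rfl
  rw [h00]
  exact breatheFamily_zero B d

/-- **Every member of the breathing curve agrees with `d` off the compact core**
`breatheCore e z₀ r`. [cite: LeeSmoothManifolds2013, Prop. 2.25] -/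
theorem breatheCurve_agree_off_core (c : EuclideanSpace ℝ (Fin 1)) {x : X}
    (hx : x ∉ breatheCore e z₀ r) :
    (breatheFamily B d (c 0)).h.inner x = d.h.inner x ∧ (breatheFamily B d (c 0)).k x = d.k x :=
  breatheFamily_eq_of_not_mem_core B d (c 0) hx

/-- **The breathing curve is injective** (the centre marker `t ↦ h_{E t}(x₀)(v₀, v₀)` is injective
and `c ↦ c 0` is a bijection `ℝ¹ → ℝ`). [cite: LeeSmoothManifolds2013, Prop. 2.25] -/
theorem injective_breatheCurve :
    Injective (fun c : EuclideanSpace ℝ (Fin 1) ↦ breatheFamily B d (c 0)) := by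
  intro c c' h
  have hv : ((EuclideanSpace.single (0 : Fin 3) (1 : ℝ) : E3) :
      TangentSpace (𝓡 3) (e.dataChartExt z₀)) ≠ 0 := by
    have : (EuclideanSpace.single (0 : Fin 3) (1 : ℝ) : E3) ≠ 0 := by
      rw [← norm_ne_zero_iff, PiLp.norm_single, norm_one]
      exact one_ne_zero
    exact this
  have h' := congrArg (fun D : InitialDataSet (𝓡 3) X ↦ D.h.inner (e.dataChartExt z₀)
    ((EuclideanSpace.single (0 : Fin 3) (1 : ℝ) : E3) : TangentSpace (𝓡 3) (e.dataChartExt z₀))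
    ((EuclideanSpace.single (0 : Fin 3) (1 : ℝ) : E3) : TangentSpace (𝓡 3) (e.dataChartExt z₀))) h
  have key : c 0 = c' 0 := injective_marker B d hv h'
  ext i
  fin_cases i
  exact key

/-- **The breathing curve is IMMERSED at the base parameter.** For a parameter direction `v ≠ 0`
of `ℝ¹`, at the centre `x₀ = Φₑ z₀` and for `v₀ = e₀ ≠ 0`,
`c ↦ h_{E_{c₀}}(x₀)(v₀, v₀) = (1 + σ c₀)² h_d(x₀)(v₀, v₀)` (`breatheFamily_h_inner_center`) has
derivative at `0` in the direction `v` equal to `2 (s₀/π) h_d(x₀)(v₀, v₀) · v₀‑coordinate of v`,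
non-zero because `σ'(0) = s₀/π > 0` (`σ = (s₀/π) arctan`), `h_d(x₀)(v₀, v₀) > 0` and the
coordinate of `v` is non-zero. Christodoulou, CQG 16 (1999), p. A24 (independent directions);
Lee 2013, Prop. 2.25. [cite: Christodoulou1999, p. A24] -/
theorem isImmersedAtZero_breatheCurve :
    InitialDataSet.IsImmersedAtZero 1
      (fun c : EuclideanSpace ℝ (Fin 1) ↦ breatheFamily B d (c 0)) := by
  intro v hv
  -- the direction has a non-zero coordinate
  have hv0 : v 0 ≠ 0 := by
    intro h
    apply hv
    ext i
    fin_cases i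
    simpa using h
  -- the centre, a non-zero tangent vector, and positivity of the marker
  set x₀ : X := e.dataChartExt z₀ with hx₀
  set v₀ : TangentSpace (𝓡 3) x₀ := (EuclideanSpace.single (0 : Fin 3) (1 : ℝ) : E3) with hv₀
  have hv₀ne : v₀ ≠ 0 := by
    have h : (EuclideanSpace.single (0 : Fin 3) (1 : ℝ) : E3) ≠ 0 := by
      rw [← norm_ne_zero_iff, PiLp.norm_single, norm_one]
      exact one_ne_zero
    exact h
  have hA : 0 < d.h.inner x₀ v₀ v₀ := d.h.pos x₀ v₀ hv₀ne
  refine ⟨x₀, v₀, v₀, Or.inl ?_⟩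
  -- the marker along the curve is `g (c 0)` with `g t = (1 + σ t)² h_d(x₀)(v₀, v₀)`
  have hline : (fun c : EuclideanSpace ℝ (Fin 1) ↦ (breatheFamily B d (c 0)).h.inner x₀ v₀ v₀) =
      fun c ↦ (1 + squash B (c 0)) ^ 2 * d.h.inner x₀ v₀ v₀ :=
    funext fun c ↦ breatheFamily_h_inner_center B d (c 0) v₀ v₀
  have hsq : HasDerivAt (squash B) (breatheScale B / Real.pi) 0 := by
    have h := (Real.hasDerivAt_arctan 0).const_mul (breatheScale B / Real.pi)
    simp only [ne_eq, OfNat.ofNat_ne_zero, not_false_eq_true, zero_pow, add_zero, div_one,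
      mul_one] at h
    exact h
  have hg : HasDerivAt (fun t : ℝ ↦ (1 + squash B t) ^ 2 * d.h.inner x₀ v₀ v₀)
      (((2 : ℕ) * (1 + squash B 0) ^ (2 - 1) * (breatheScale B / Real.pi)) * d.h.inner x₀ v₀ v₀)
      ((fun c : EuclideanSpace ℝ (Fin 1) ↦ c 0) 0) :=
    ((hsq.const_add 1).pow 2).mul_const _
  have hproj : HasFDerivAt (𝕜 := ℝ) (fun c : EuclideanSpace ℝ (Fin 1) ↦ c 0)
      (PiLp.proj (𝕜 := ℝ) 2 (fun _ : Fin 1 ↦ ℝ) 0) 0 :=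
    PiLp.hasFDerivAt_apply 2 (0 : EuclideanSpace ℝ (Fin 1)) 0
  have hcomp : HasFDerivAt
      (fun c : EuclideanSpace ℝ (Fin 1) ↦ (1 + squash B (c 0)) ^ 2 * d.h.inner x₀ v₀ v₀)
      ((((2 : ℕ) * (1 + squash B 0) ^ (2 - 1) * (breatheScale B / Real.pi)) * d.h.inner x₀ v₀ v₀) •
        PiLp.proj (𝕜 := ℝ) 2 (fun _ : Fin 1 ↦ ℝ) 0) 0 := by
    have hcomp0 := hg.comp_hasFDerivAt (0 : EuclideanSpace ℝ (Fin 1)) hproj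
    exact hcomp0
  rw [hline, hcomp.fderiv]
  simp only [FunLike.coe_smul, Pi.smul_apply, PiLp.proj_apply, squash_zero, smul_eq_mul]
  have hs₀ := (breatheScale_spec B).1
  have h2 : ((2 : ℕ) : ℝ) * (1 + 0) ^ (2 - 1) * (breatheScale B / Real.pi) * d.h.inner x₀ v₀ v₀ ≠ 0 := by
    positivity
  exact mul_ne_zero h2 hv0

/-- **The breathing curve is TAME on every collared end** `e.restrict _`, `R₁ > e.R`, when `e` is a
sole end on which `d` is Dafermos–Rodnianski flat with mass `M` (all members agree with `d` off the
compact core, so `InitialDataSet.isTameDataFamily_restrict_of_agree_off_compact` applies: constant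
mass `M`, `wDist → 0` by uniform `C² × C¹` smallness on a compact annulus).
[cite: Christodoulou1999, p. A24] -/
theorem isTameDataFamily_restrict_breatheCurve (he : e.IsSoleEnd) {M : ℝ}
    (hSAF : e.IsStronglyAsymptoticallyFlatDR d M) {R₁ : ℝ} (hR₁ : e.R < R₁) :
    InitialDataSet.IsTameDataFamily (e.restrict hR₁.le) 1
      (fun c : EuclideanSpace ℝ (Fin 1) ↦ breatheFamily B d (c 0)) := by
  have h0 : breatheFamily B d ((0 : EuclideanSpace ℝ (Fin 1)) 0) = d := breatheCurve_zero B d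
  refine InitialDataSet.isTameDataFamily_restrict_of_agree_off_compact
    (isSmoothDataFamily_breatheCurve B d) he (M := M) ?_ (isCompact_breatheCore B) ?_ hR₁
  · show e.IsStronglyAsymptoticallyFlatDR (breatheFamily B d ((0 : EuclideanSpace ℝ (Fin 1)) 0)) M
    rw [h0]
    exact hSAF
  · intro c x hx
    show (breatheFamily B d (c 0)).h.inner x =
        (breatheFamily B d ((0 : EuclideanSpace ℝ (Fin 1)) 0)).h.inner x ∧
      (breatheFamily B d (c 0)).k x = (breatheFamily B d ((0 : EuclideanSpace ℝ (Fin 1)) 0)).k x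
    rw [h0]
    exact breatheFamily_eq_of_not_mem_core B d (c 0) hx

variable [SecondCountableTopology X] [ConnectedSpace X]

/-- **The breathing curve of an admissible datum consists of admissible data** (vacuum constraints
are natural under diffeomorphisms, `isVacuumConstraintSolution_breatheFamily`; completeness and the
sole, flat end pass to data agreeing off a compact set,
`mem_admissibleVacuumData_of_agree_off_compact`). [cite: BartnikIsenberg2004, §2] -/
theorem breatheCurve_mem_admissibleVacuumData (hd : d ∈ admissibleVacuumData X)
    (c : EuclideanSpace ℝ (Fin 1)) :
    breatheFamily B d (c 0) ∈ admissibleVacuumData X := by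
  refine InitialDataSet.mem_admissibleVacuumData_of_agree_off_compact hd ?_ (isCompact_breatheCore B)
    (fun x hx ↦ breatheFamily_eq_of_not_mem_core B d (c 0) hx)
  intro inst
  haveI : d.metric.HasLeviCivita := d.metric.hasLeviCivita
  exact isVacuumConstraintSolution_breatheFamily B d hd.1.1 (c 0)

end AFEnd

namespace InitialDataSet

variable {X : Type} [TopologicalSpace X] [ChartedSpace E3 X] [IsManifold (𝓡 3) ∞ X] [T2Space X]
  [SecondCountableTopology X] [ConnectedSpace X]

/-- **Tame self-witnesses exist through every admissible datum.** For every
`d ∈ admissibleVacuumData X` there are an asymptotically flat end `e` of `X` and a one-parameter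
family `F : ℝ¹ → InitialDataSet (𝓡 3) X` with: `F` TAME on `e` (`IsTameDataFamily`), immersed at
`0`, `F 0 = d`, injective, every member admissible, and every member equal to `d` (same metric,
same second fundamental form) off one fixed compact set. Witness: the breathing curve of `d` on a
coordinate ball far out on the sole end of `d`, read on a collared restriction of that end. In
particular the witness notion of the TAME final state conjecture (`IsTameChristodoulouGeneric … 1`:
tame, immersed, injective admissible curves) is satisfiable through every admissible datum, and a
property of admissible data invariant under "agrees with `d` off a compact set and is an isometric
copy of `d`" holds along the whole curve whenever it holds at `d`.
[cite: Christodoulou1999, p. A24] -/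
theorem exists_tame_selfWitness {d : InitialDataSet (𝓡 3) X} (hd : d ∈ admissibleVacuumData X) :
    ∃ (e : AFEnd X) (F : EuclideanSpace ℝ (Fin 1) → InitialDataSet (𝓡 3) X),
      IsTameDataFamily e 1 F ∧ IsImmersedAtZero 1 F ∧ F 0 = d ∧ Injective F ∧
        (∀ c, F c ∈ admissibleVacuumData X) ∧
          ∃ K : Set X, IsCompact K ∧ ∀ c, ∀ x ∉ K, (F c).h.inner x = d.h.inner x ∧ (F c).k x = d.k x := by
  obtain ⟨-, e, M, hsole, hdecay⟩ := id hd
  -- a breathing ball far out on the end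
  set z₀ : E3 := (e.R + 3) • EuclideanSpace.single (0 : Fin 3) (1 : ℝ) with hz₀
  have hz₀n : ‖z₀‖ = e.R + 3 := by
    rw [hz₀, norm_smul, PiLp.norm_single, norm_one, mul_one,
      Real.norm_of_nonneg (by linarith [e.R_pos])]
  have B : e.BreathingData z₀ 1 := ⟨one_pos, by rw [hz₀n]; linarith⟩
  have hR₁ : e.R < e.R + 1 := by linarith
  refine ⟨e.restrict hR₁.le, fun c ↦ AFEnd.breatheFamily B d (c 0),
    AFEnd.isTameDataFamily_restrict_breatheCurve B d hsole hdecay hR₁,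
    AFEnd.isImmersedAtZero_breatheCurve B d, AFEnd.breatheCurve_zero B d,
    AFEnd.injective_breatheCurve B d, fun c ↦ AFEnd.breatheCurve_mem_admissibleVacuumData B d hd c,
    AFEnd.breatheCore e z₀ 1, AFEnd.isCompact_breatheCore B,
    fun c x hx ↦ AFEnd.breatheFamily_eq_of_not_mem_core B d (c 0) hx⟩

end InitialDataSet

end Literature.Geometry.Lorentzian

end
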